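/-
Copyright (c) 2026 the pub-hodgecm-mathlib formalisation cell (harness21).  Prover seat hodgecm-mathlib-F0P2-p02 (g9), ROAD W brick (W5), 2026-09-01.
-/
import Literature.NumberTheory.Automorphic.OrbitalIntegralFixedPointsPerPeriodTorus   -- ★ p843359 (S4a): `classOrbitalIntegral_indicator[_complex]_eq_mul_natCard_quotient_zpowers`
import Literature.Combinatorics.SimpleGraph.TreeActionNonEllipticPerPeriod             -- (W5) F0P2-p02 (g9): `natCard_quotient_fixedBy_add_eq_natCard_quotient_fixedBy_of_treeAction`
import HarnessLib

/-!
# Kottwitz's NON-ELLIPTIC Euler–Poincaré relation `ν(K_v)⁻¹Φ(⟦γ⟧, 𝟙_{K_v}) + ν(K_e)⁻¹Φ(⟦γ⟧, 𝟙_{K_e}) − ν(I)⁻¹Φ(⟦γ⟧, 𝟙_I) = 0` for a locally compact group acting on a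
# tree with one orbit of vertices and one orbit of darts, at a split-torus class (Kottwitz 1988 §2 Thm. 2; Laumon 1996 (5.3.2); Serre, *Trees* I.6, II.1)

Topic `NumberTheory/Automorphic`; namespace `Literature.NumberTheory.Automorphic`.  THEOREMS ONLY (no definition, no instance, no notation, no named fact, no `sorry`); kernel
lane.  Cell `pub/hodgecm-mathlib`, F0∕P3a, crux H413 = stmt-HodgeConjecture-24833, line «N6nsGerm», residue `stub_N6nsR2ram : RankOneEulerPoincareNonsplitRamified`, ROAD W
(«R2EP-wild», MEMO `F0/P3a/F0P3a-p04/g13/MEMO-R2wild.F0P3a-p04g13.md`), brick (W5), ORBITAL-INTEGRAL FORM; seat F0P2-p02 (g9) (census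
`F0/P2/p02/g9/CENSUS-W5-NonEllipticPerPeriod.F0P2p02g9.md` «THEOREM C»).  HONEST LABEL: HC_CM is proved only modulo the printed citations until rung 0 closes; this file
is unconditional orbit counting + the ★ per-period engine and asserts nothing printed.

THE MATHEMATICS.  `G` locally compact acts on a tree `X` by automorphisms with one orbit of vertices and one orbit of darts (inversions allowed); `Kv`, `Ke`, `I` the
stabilisers of `v₀`, `{v₀, v₁}`, `(v₀, v₁)` — compact open.  `γ ∈ G` with commutative centraliser `Z_G(γ)` whose compact core is compact open, and `τ ∈ Z_G(γ)` generating
`Z_G(γ)` modulo the compact core and meeting it trivially (a split torus `Z_G(γ) = τ^ℤ × Z_G(γ)_c`); on the tree, `τ` translates `v₀` to a neighbour and acts freely on it, and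
`γ` moves `v₀` along the axis of `τ` (`γ v₀ = τ^k v₀`).  For a canonical orbital-measure family `m` (for `P`, Haar `ν`) with `P γ` and the class of `γ` closed, ★
`classOrbitalIntegral_indicator_complex_eq_mul_natCard_quotient_zpowers` gives `Φ(⟦γ⟧, 𝟙_C) = ν(C) · #(Fix_γ(G⧸C)∕τ^ℤ)` (and the finiteness of the quotient) for
`C ∈ {Kv, Ke, I}`, and ★ `natCard_quotient_fixedBy_add_eq_natCard_quotient_fixedBy_of_treeAction` ((W5) coset side) is `#Kv + #Ke = #I` per period; hence
**`((ν Kv).toReal : ℂ)⁻¹ Φ(⟦γ⟧, 𝟙_{Kv}) + ((ν Ke).toReal : ℂ)⁻¹ Φ(⟦γ⟧, 𝟙_{Ke}) − ((ν I).toReal : ℂ)⁻¹ Φ(⟦γ⟧, 𝟙_I) = 0`** — the summand of the binder `hN` of ★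
`exists_isLocSmooth_classOrbitalIntegral_eq_one_zero_of_ramified_of_nonEllipticRelation` (B-p14 (g32) p843526) at the levels `(K♯_D, K, K♯_D ⊓ K)`, in its tokens, once (W1c)(W2)
(B-p08 (g28)) identify `U(Φ₂)(E_w)`'s two stabilisers on the tree of `SL₂(F_v)` with `K♯_D`, `K` (in either order: the relation is symmetric in `Kv ↔ Ke`) and the split
torus `t_x` is brought to `act t_x v₀ = act t_{ϖ_E}^{ord x} v₀` ((g-D) ★).  No finiteness hypothesis remains (the ★ engine supplies it).

* `epCombination_classOrbitalIntegral_eq_zero_of_treeAction` (action `G →* (X ≃g X)`) and `…_of_vertexAction` (action given on vertices).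

## References
* [Kottwitz1988] R. E. Kottwitz, *Tamagawa numbers*, Ann. of Math. 127 (1988), 629–646, §2 Theorem 2 (non-elliptic case: `O_γ(f_EP) = 0`).
* [Laumon1995] G. Laumon, *Cohomology of Drinfeld Modular Varieties* I (1996), Lemma (5.3.2) p. 136.
* [Serre1980Trees] J.-P. Serre, *Trees* (1980), I.6.1, I.6.4 Prop. 24–25, II.1.1–1.3.
* [Rogawski1990] J. D. Rogawski, *Automorphic Representations of Unitary Groups in Three Variables* (1990), §12.6 p. 174 («`Φ(γ, f) = 0` for `γ ∈ G^r − G^e`»).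
-/

set_option autoImplicit false

noncomputable section

open MeasureTheory Measure Topology Set MulAction SimpleGraph
open scoped ENNReal NNReal

namespace Literature.NumberTheory.Automorphic

open Literature.Combinatorics.SimpleGraph.TreeAction

/-- `((ν K).toReal : ℂ) ≠ 0` for a compact open subgroup under a Haar measure. [cite: Kottwitz1988, §2] -/
private theorem toReal_measure_ne_zero_of_isOpen_isCompact {H : Type*} [Group H] [TopologicalSpace H] [MeasurableSpace H]
    (ν : Measure H) [ν.IsHaarMeasure] (K : Subgroup H) (hK : IsOpen (K : Set H)) (hKc : IsCompact (K : Set H)) :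
    (((ν K).toReal : ℝ) : ℂ) ≠ 0 := by
  rw [Ne, Complex.ofReal_eq_zero, ENNReal.toReal_eq_zero_iff, not_or]
  exact ⟨(hK.measure_pos ν ⟨1, K.one_mem⟩).ne', hKc.measure_lt_top.ne⟩

variable {G : Type*} [Group G] [TopologicalSpace G] [IsTopologicalGroup G] [LocallyCompactSpace G]
  [SecondCountableTopology G] [T2Space G] [MeasurableSpace G] [BorelSpace G]
  [∀ γ : G, MeasurableSpace (G ⧸ Subgroup.centralizer ({γ} : Set G))]
  [∀ γ : G, BorelSpace (G ⧸ Subgroup.centralizer ({γ} : Set G))]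

/-- **KOTTWITZ'S NON-ELLIPTIC EULER–POINCARÉ RELATION FOR A GROUP ACTING ON A TREE WITH ONE ORBIT OF VERTICES AND ONE ORBIT OF DARTS, AT A SPLIT-TORUS CLASS.**
`G` acts on the tree `X` by automorphisms (`act`), transitively on vertices (`hV`) and darts (`hD`); `Kv = Stab(v₀)`, `Ke = Stab{v₀, v₁}`, `I = Stab(v₀, v₁)` compact open;
`m` canonical for `(P, ν)`, `P γ`, the class of `γ` closed; `Z_G(γ)` commutative with compact open compact core, `τ ∈ Z_G(γ)` with (gen)∕(free) — the hypotheses of ★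
`classOrbitalIntegral_indicator_complex_eq_mul_natCard_quotient_zpowers` — and on the tree `v₀ ∼ τ v₀`, `τ^n v₀ = v₀ ⇒ n = 0`, `γ v₀ = τ^k v₀`.  Then
`((ν Kv).toReal : ℂ)⁻¹ Φ(⟦γ⟧, 𝟙_{Kv}) + ((ν Ke).toReal : ℂ)⁻¹ Φ(⟦γ⟧, 𝟙_{Ke}) − ((ν I).toReal : ℂ)⁻¹ Φ(⟦γ⟧, 𝟙_I) = 0`.
[cite: Kottwitz1988, §2 Theorem 2] [cite: Laumon1995, Lemma (5.3.2) p. 136] [cite: Serre1980Trees, I.6.1; I.6.4; II.1.1–1.3] [cite: Rogawski1990, §12.6 p. 174] -/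
theorem epCombination_classOrbitalIntegral_eq_zero_of_treeAction {P : G → Prop} (hP : ∀ g x : G, P g → P (x * g * x⁻¹))
    {ν : Measure G} [ν.IsHaarMeasure] [ν.IsMulRightInvariant] {m : OrbitalMeasureFamily G} (hm : m.IsCanonical P ν)
    {V : Type*} {X : SimpleGraph V} (hT : X.IsTree) (act : G →* (X ≃g X))
    {v₀ v₁ : V} (h01 : X.Adj v₀ v₁) (hV : ∀ v : V, ∃ g : G, act g v₀ = v)
    (hD : ∀ a b : V, X.Adj a b → ∃ g : G, act g v₀ = a ∧ act g v₁ = b)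
    (Kv Ke I : Subgroup G) (hKv : ∀ g : G, g ∈ Kv ↔ act g v₀ = v₀)
    (hKe : ∀ g : G, g ∈ Ke ↔ s(act g v₀, act g v₁) = s(v₀, v₁))
    (hI : ∀ g : G, g ∈ I ↔ act g v₀ = v₀ ∧ act g v₁ = v₁)
    (hKvo : IsOpen (Kv : Set G)) (hKvc : IsCompact (Kv : Set G)) (hKeo : IsOpen (Ke : Set G)) (hKec : IsCompact (Ke : Set G))
    (hIo : IsOpen (I : Set G)) (hIc : IsCompact (I : Set G))
    {γ : G} (hγ : P γ) (hO : IsClosed {g | ∃ y : G, y * γ * y⁻¹ = g})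
    (hcomm : ∀ a b : Subgroup.centralizer ({γ} : Set G), a * b = b * a)
    (hc : IsCompact (compactCore (Subgroup.centralizer ({γ} : Set G)))) (ho : IsOpen (compactCore (Subgroup.centralizer ({γ} : Set G))))
    (τ : Subgroup.centralizer ({γ} : Set G))
    (hgen : ∀ c : Subgroup.centralizer ({γ} : Set G), ∃ n : ℤ, c * (τ ^ n)⁻¹ ∈ compactCore (Subgroup.centralizer ({γ} : Set G)))
    (hfree : ∀ n : ℤ, τ ^ n ∈ compactCore (Subgroup.centralizer ({γ} : Set G)) → n = 0)
    (hstep : X.Adj v₀ (act (τ : G) v₀)) (hfreeV : ∀ n : ℤ, act ((τ : G) ^ n) v₀ = v₀ → n = 0)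
    (hγτ : ∃ k : ℤ, act γ v₀ = act ((τ : G) ^ k) v₀) :
    (((ν Kv).toReal : ℂ))⁻¹ * classOrbitalIntegral m ((Kv : Set G).indicator fun _ => (1 : ℂ)) (ConjClasses.mk γ) +
        (((ν Ke).toReal : ℂ))⁻¹ * classOrbitalIntegral m ((Ke : Set G).indicator fun _ => (1 : ℂ)) (ConjClasses.mk γ) -
        (((ν I).toReal : ℂ))⁻¹ * classOrbitalIntegral m ((I : Set G).indicator fun _ => (1 : ℂ)) (ConjClasses.mk γ) = 0 := by
  -- the ★ per-period engine at the three levels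
  rw [classOrbitalIntegral_indicator_complex_eq_mul_natCard_quotient_zpowers hP hm hγ hcomm hc ho τ hgen hfree Kv hKvo hKvc hO,
    classOrbitalIntegral_indicator_complex_eq_mul_natCard_quotient_zpowers hP hm hγ hcomm hc ho τ hgen hfree Ke hKeo hKec hO,
    classOrbitalIntegral_indicator_complex_eq_mul_natCard_quotient_zpowers hP hm hγ hcomm hc ho τ hgen hfree I hIo hIc hO]
  have hfinI := (classOrbitalIntegral_indicator_eq_mul_natCard_quotient_zpowers hP hm hγ hcomm hc ho τ hgen hfree I hIo hIc hO).1
  rw [← mul_assoc, ← mul_assoc, ← mul_assoc, inv_mul_cancel₀ (toReal_measure_ne_zero_of_isOpen_isCompact ν Kv hKvo hKvc),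
    inv_mul_cancel₀ (toReal_measure_ne_zero_of_isOpen_isCompact ν Ke hKeo hKec), inv_mul_cancel₀ (toReal_measure_ne_zero_of_isOpen_isCompact ν I hIo hIc),
    one_mul, one_mul, one_mul, sub_eq_zero, ← Nat.cast_add, Nat.cast_inj]
  -- the per-period identity (W5)
  have hτ : (τ : G) * γ = γ * (τ : G) := Subgroup.mem_centralizer_singleton_iff.1 τ.2
  have hτeq : (⟨(τ : G), Subgroup.mem_centralizer_singleton_iff.2 hτ⟩ : Subgroup.centralizer ({γ} : Set G)) = τ := Subtype.ext rfl
  have key := natCard_quotient_fixedBy_add_eq_natCard_quotient_fixedBy_of_treeAction hT act h01 hV hD Kv Ke I hKv hKe hI γ (τ : G) hτ hstep hfreeV hγτ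
  rw [hτeq] at key
  exact key hfinI

/-- **The same, for an action given on vertices** (`act g : V → V` with `act 1 = id`, `act (g h) = act g ∘ act h`, adjacency-preserving — the shape of ★ `glVertexAct`
and of B-p08 (g28)'s `rhoVertexAct`). [cite: Kottwitz1988, §2 Theorem 2] [cite: Laumon1995, Lemma (5.3.2) p. 136] [cite: Serre1980Trees, I.6.1; II.1.1–1.3] -/
theorem epCombination_classOrbitalIntegral_eq_zero_of_vertexAction {P : G → Prop} (hP : ∀ g x : G, P g → P (x * g * x⁻¹))
    {ν : Measure G} [ν.IsHaarMeasure] [ν.IsMulRightInvariant] {m : OrbitalMeasureFamily G} (hm : m.IsCanonical P ν)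
    {V : Type*} {X : SimpleGraph V} (hT : X.IsTree) (act : G → V → V)
    (act_one : ∀ v : V, act 1 v = v) (act_mul : ∀ (g h : G) (v : V), act (g * h) v = act g (act h v))
    (act_adj : ∀ (g : G) (a b : V), X.Adj (act g a) (act g b) ↔ X.Adj a b)
    {v₀ v₁ : V} (h01 : X.Adj v₀ v₁) (hV : ∀ v : V, ∃ g : G, act g v₀ = v)
    (hD : ∀ a b : V, X.Adj a b → ∃ g : G, act g v₀ = a ∧ act g v₁ = b)
    (Kv Ke I : Subgroup G) (hKv : ∀ g : G, g ∈ Kv ↔ act g v₀ = v₀)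
    (hKe : ∀ g : G, g ∈ Ke ↔ s(act g v₀, act g v₁) = s(v₀, v₁))
    (hI : ∀ g : G, g ∈ I ↔ act g v₀ = v₀ ∧ act g v₁ = v₁)
    (hKvo : IsOpen (Kv : Set G)) (hKvc : IsCompact (Kv : Set G)) (hKeo : IsOpen (Ke : Set G)) (hKec : IsCompact (Ke : Set G))
    (hIo : IsOpen (I : Set G)) (hIc : IsCompact (I : Set G))
    {γ : G} (hγ : P γ) (hO : IsClosed {g | ∃ y : G, y * γ * y⁻¹ = g})
    (hcomm : ∀ a b : Subgroup.centralizer ({γ} : Set G), a * b = b * a)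
    (hc : IsCompact (compactCore (Subgroup.centralizer ({γ} : Set G)))) (ho : IsOpen (compactCore (Subgroup.centralizer ({γ} : Set G))))
    (τ : Subgroup.centralizer ({γ} : Set G))
    (hgen : ∀ c : Subgroup.centralizer ({γ} : Set G), ∃ n : ℤ, c * (τ ^ n)⁻¹ ∈ compactCore (Subgroup.centralizer ({γ} : Set G)))
    (hfree : ∀ n : ℤ, τ ^ n ∈ compactCore (Subgroup.centralizer ({γ} : Set G)) → n = 0)
    (hstep : X.Adj v₀ (act (τ : G) v₀)) (hfreeV : ∀ n : ℤ, act ((τ : G) ^ n) v₀ = v₀ → n = 0)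
    (hγτ : ∃ k : ℤ, act γ v₀ = act ((τ : G) ^ k) v₀) :
    (((ν Kv).toReal : ℂ))⁻¹ * classOrbitalIntegral m ((Kv : Set G).indicator fun _ => (1 : ℂ)) (ConjClasses.mk γ) +
        (((ν Ke).toReal : ℂ))⁻¹ * classOrbitalIntegral m ((Ke : Set G).indicator fun _ => (1 : ℂ)) (ConjClasses.mk γ) -
        (((ν I).toReal : ℂ))⁻¹ * classOrbitalIntegral m ((I : Set G).indicator fun _ => (1 : ℂ)) (ConjClasses.mk γ) = 0 := by
  -- assemble `G →* (X ≃g X)` exactly as in ★ `natCard_fixedBy_add_eq_natCard_fixedBy_add_one_of_vertexAction`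
  have hinv₁ : ∀ (g : G) (v : V), act g⁻¹ (act g v) = v := fun g v => by rw [← act_mul, inv_mul_cancel, act_one]
  have hinv₂ : ∀ (g : G) (v : V), act g (act g⁻¹ v) = v := fun g v => by rw [← act_mul, mul_inv_cancel, act_one]
  let ι : G → (X ≃g X) := fun g =>
    { toFun := act g
      invFun := act g⁻¹
      left_inv := hinv₁ g
      right_inv := hinv₂ g
      map_rel_iff' := by intro a b; exact act_adj g a b }
  have hι : ∀ (g : G) (v : V), ι g v = act g v := fun _ _ => rfl
  let ιh : G →* (X ≃g X) :=
    { toFun := ι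
      map_one' := RelIso.ext fun v => by rw [hι, act_one]; rfl
      map_mul' := fun a b => RelIso.ext fun v => by rw [RelIso.mul_apply, hι, hι, hι, act_mul] }
  exact epCombination_classOrbitalIntegral_eq_zero_of_treeAction hP hm hT ιh h01 hV hD Kv Ke I hKv hKe hI hKvo hKvc hKeo hKec hIo hIc hγ hO hcomm hc ho τ
    hgen hfree hstep hfreeV hγτ

end Literature.NumberTheory.Automorphic

end
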